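import Summits.QuantumFields.BalabanUV.Beta.GAN24.SigmaPairSlotMomentsExitSame

/-!
# `BalabanUV.Beta.GAN24.SigmaPairTransportedMomentsExit` — binder row G-an2-4 ∕ (CONV-C), the (S) row of RULING R-gan24p1-g27-1 PART B (viii), the σ-pair IN THE TRANSPORTED
# CURRENCY the (LT-3) consumer reads: **the coarse field–field charge per slot of `G_k ∘ [(α)_y(ν,y′) − ½cH_k·gauge-read_k(y;ν,y′)] ∘ G_k` (the two pieces' sandwiches, added)
# IS `−Lc²·σ_k²·Z_k(y′)`, `σ_k = ((Lc^{k+1})^{d+2})⁻¹`, `Z_k` = the exit⊗exit profile of `SigmaPairSlotMomentsExit` — at EVERY level `k ≥ 0`; hence its (M0) ∧ (Π) are those of `Z_k`: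
# modulo (W-γ)_k at level `k`, with NO displayed hypothesis at level 0 (`α ≠ β`: centred root, `Lc` odd, pin `cE = Lc^{d+1}`; `α = β`: any root)**
# (G-an2-4 formalisation swarm → CRUX TEAM (2), seat `b2b-balaban-gan24-formalise-leaf-02`, gen 59, INTENT 4)

NOT IN PRINT; OUR BOOKKEEPING ([folklore] composition BY NAME: road-P2 g35 `SandwichReadoutSiteDep.hasSum_sandwich_readout_coDressKBmAt`, g38 `WardResidualRotatedVertexTransported`
(§1 below is its `hasSum_prod_transported_rotatedVertex_comb` with the level token `j + 1 ↦ k` — same proof; the `k = j+1` member is that theorem), leaf-06 `StepResolventLegCharges.hasSum_KInvStep_inr_inl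
∕ _inl_inr`, `MultiplierZeroMass.hasSum_KInvStep_mm_left ∕ _right`, `GaugeReadChargeComb.hasSum_prod_comb_transported_gaugeSup` (level-generic), MY `CubicPushFaceCharge.sum_sum_face_kron`,
this seat's `RotatedVertexSlotInversionAllLevels.hasSum_weighted_rotatedVertex_comb_level` and `SigmaPairSlotMomentsExit(Same)`; 0 `def`, 0 cited fact, 0 `def … : Prop`, 0 sorry).
HONEST FRAMING (cell contract, verbatim): «discharging `BetaPertH` makes Bałaban's UV stability UNCONDITIONAL — a real constructive-QFT result; it is NOT the continuum limit and NOT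
the Clay problem.»  HONEST DEPENDENCY (verbatim): «continuum YM on T⁴ ⇐ BetaPertH ∧ nine spine estimates (0/9 proved); BetaPertH ⇐ (D1) ∧ (D4) ∧ CAP+tail; G-an2-4 gates asym, D1
and NE2/3/4.»
* §1 `biLoc_rotatedVertex_comb_level`, **`hasSum_prod_transported_rotatedVertex_comb_level`** — road-P2 g38's transported (α)-letter per slot at level `k` (any in-block root).
* §2 `faceWt_eq_exitWt` (the ∧-face weight is the product weight).
* §3 **`hasSum_transported_sigmaPair_exit_level`** — THE TRANSPORTED σ-PAIR (any in-block root, all `cE cVH cΛ`, every `k y ν y′ α β`): `HasSum` of the coarse `(inr α, inr β)`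
  entries of `G_k ∘ (α) ∘ G_k + (−½cH_k)·G_k ∘ gauge-read_k ∘ G_k` at `(Lc•x′, Lc•z′)` with value `−Lc²σ_k²·(Vα_k(y′) − ½cH_k·Q^{comb}_k(y′))` in the PRODUCT-weight currency of
  `SigmaPairSlotMomentsExit` (§1 + leaf-06's (γ) twin, §2).
* §4 `moments_smul` and the three corollaries **`moments_transported_sigmaPair_exit_of_ward_level`** (centred root, `Lc` odd, modulo (W-γ)_k), **`…_levelZero`** (pin `cE = Lc^{d+1}`,
  `α ≠ β`, NO displayed hypothesis), **`…_same_level`** (`α = β`, any root, unconditional): the transported profile `y′ ↦ −Lc²σ_k²·Z_k(y′)` has zero mass and zero first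
  slot-moments — the `hM0 ∕ hP1` sockets of leaf-01's (LT-3) `LayerPushMoments.abs_tsum_mul_le_of_moments` for the σ-pair piece, literally.
WHAT THIS FILE DOES NOT DO.  The other pieces of the first-order data (`vertexOfM G_k (RM y)`, the table-law letters), plain⊗exit ∕ plain⊗plain, (W-γ)_{k≥1}; asserts NO value of
Bałaban's tables; NOTHING of (Q-R) ∕ (DL) ∕ (LT) ∕ «T2Shape» ∕ (hW, hWall); NEVER «G-an2-4 closed» as (CONV-C); NOT D1, NOT `BetaPertH`, NOT continuum, NOT Clay.  2026-08-22.
-/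

noncomputable section

open Finset
open scoped BigOperators
open Literature.MathematicalPhysics.QuantumFieldTheory
open Literature.MathematicalPhysics.QuantumFieldTheory.Balaban1983to89
open Literature.MathematicalPhysics.QuantumFieldTheory.Balaban1983to89.Beta
open ExpKernelCalculus (Site MKer BiLoc Decays comp)
open AffineAveraging (box toSite)
open AveragingContours (blk)
open AveragingContoursRooted (ctrOff ctrOff_mem_box)
open OneStepResolventKernel (Fib LocStencil wsum)
open OneStepKernelFamily (KInvStep colH decays_KInvStep)
open BalabanStepJets (locStencil_mono)
open SecondOrderResponse (colM dM vertexFamily_dM)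
open InterLevelTransport (cwsum)
open Summit.QuantumFields.BalabanUV.Beta.BorderedHessian (diagK stepScale)
open Summit.QuantumFields.BalabanUV.Beta.ChartConjugation (conjV)
open Summit.QuantumFields.BalabanUV.Beta.AveragingWardRootedStencils (legInd)
open Summit.QuantumFields.BalabanUV.Beta.AxialDressingRooted (coDressKBmAt decays_coDressKBmAt_KInvStep)
open Summit.QuantumFields.BalabanUV.Beta.SpineRooted (SpureRecAt M1At locStencil_SpureRecAt vertexFamily_M1At)
open Summit.QuantumFields.BalabanUV.Beta.KernelWardRelative (gaugeWt)
open Summit.QuantumFields.BalabanUV.Beta.WardLocusResidualClass (abs_blockGen_le)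
open Summit.QuantumFields.BalabanUV.Beta.GAN24.WardResidualLabelSums (decays_conjV_diagK)
open Summit.QuantumFields.BalabanUV.Beta.GAN24.SandwichReadoutSiteDep (hasSum_sandwich_readout_coDressKBmAt)
open Summit.QuantumFields.BalabanUV.Beta.GAN24.StepResolventLegCharges (hasSum_KInvStep_inr_inl hasSum_KInvStep_inl_inr)
open Summit.QuantumFields.BalabanUV.Beta.GAN24.MultiplierZeroMass (hasSum_KInvStep_mm_left hasSum_KInvStep_mm_right)
open Summit.QuantumFields.BalabanUV.Beta.GAN24.CubicPushFaceCharge (sum_sum_face_kron)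
open Summit.QuantumFields.BalabanUV.Beta.GAN24.GaugeReadChargeComb (hasSum_prod_comb_transported_gaugeSup)
open Summit.QuantumFields.BalabanUV.Beta.GAN24.RotatedVertexSlotInversionAllLevels (hasSum_weighted_rotatedVertex_comb_level)
open Summit.QuantumFields.BalabanUV.Beta.GAN24.SigmaPairSlotMomentsExit (moments_sigmaPair_exit_of_ward_level moments_sigmaPair_exit_levelZero)
open Summit.QuantumFields.BalabanUV.Beta.GAN24.SigmaPairSlotMomentsExitSame (moments_sigmaPair_exit_same_level)

namespace Summit.QuantumFields.BalabanUV.Beta.GAN24.SigmaPairTransportedMomentsExit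

variable {d Lc : ℕ} [NeZero Lc]

/-! ## §1 Road-P2 g38's transported (α)-letter per slot, at level `k` -/

/-- [folklore] **(α)_y AT LEVEL `k` IS BI-LOCALISED AT ITS SLOT** (road-P2 g38 `biLoc_rotatedVertex_comb`, token `j + 1 ↦ k`, same proof). -/
theorem biLoc_rotatedVertex_comb_level (hLc : 1 ≤ Lc) {r : Fin (d + 1) → ℕ} (hr : r ∈ box (d + 1) Lc) (cE cVH cΛ : ℝ) (k : ℕ)
    (y : Fin (d + 1) → ℤ) (ν : Fin (d + 1)) (y' : Fin (d + 1) → ℤ) :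
    ∃ C m : ℝ, 0 < m ∧ BiLoc ((1 / 2 : ℝ) • dM (conjV (coDressKBmAt (toSite r) Lc (KInvStep (d := d) Lc k))
            (diagK (((1 : ℝ) / 2) • ∑ v ∈ box (d + 1) Lc, legInd (toSite r) ((Lc : ℤ) • y + toSite v)))) Lc
            (SpureRecAt d Lc (toSite r) cE cVH cΛ k) (M1At d Lc (toSite r) cΛ k) ν y') ((Lc : ℤ) • y') ((Lc : ℤ) • y') C m := by
  obtain ⟨δG, CG, hδG, hCG, hG⟩ := decays_coDressKBmAt_KInvStep (d := d) hr k
  have hg : ∀ p c, |(((1 : ℝ) / 2) • ∑ v ∈ box (d + 1) Lc, legInd (toSite r) ((Lc : ℤ) • y + toSite v)) p c| ≤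
      |((1 : ℝ) / 2)| * (box (d + 1) Lc).card := fun p c => abs_blockGen_le Lc (toSite r) _ y p c
  have hK := decays_conjV_diagK hG hg
  obtain ⟨Cs, δs, hδs, hS⟩ := locStencil_SpureRecAt (d := d) (Lc := Lc) hLc hr cE cVH cΛ k
  have hCs : 0 ≤ Cs := (hS 0 0).nonneg (Sum.inl 0)
  set m : ℝ := min δs δG with hm
  have hm0 : 0 < m := lt_min hδs hδG
  have hSm : LocStencil (SpureRecAt d Lc (toSite r) cE cVH cΛ k) Cs m := locStencil_mono hS hCs (min_le_left _ _)
  have hM := vertexFamily_M1At (d := d) hLc hr cΛ k hm0.le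
  have hCK : 0 ≤ 2 * CG * (|((1 : ℝ) / 2)| * (box (d + 1) Lc).card) := by positivity
  have hV := vertexFamily_dM (N := Lc) hK hCK hSm hM hm0 (min_le_right _ _) ν y'
  exact ⟨_, m / 2, half_pos hm0, SecondOrderResponse.biLoc_smul (1 / 2 : ℝ) hV⟩

/-- NOT IN PRINT; OUR BOOKKEEPING.  **THE TRANSPORTED (α)-CHARGE PER SLOT AT LEVEL `k` IS A FACE-WEIGHTED BASE-POINT PROFILE** (road-P2 g38 `hasSum_prod_transported_rotatedVertex_comb`
with `j + 1 ↦ k`, same proof: the sandwich read-out with the Kronecker coarse-leg charge `σ_k = ((Lc^{k+1})^{d+2})⁻¹` of `KInvStep Lc k`, MY face-Kronecker fold, §1 of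
`RotatedVertexSlotInversionAllLevels`): the coarse `(inr α, inr β)` entries of `G_k ∘ (α)_y(ν,y′) ∘ G_k` at `(Lc•x′, Lc•z′)` have `HasSum` `−Lc²·σ_k²·V^{face}_{αβ}(y′)`. -/
theorem hasSum_prod_transported_rotatedVertex_comb_level (hLc : 1 ≤ Lc) {r : Fin (d + 1) → ℕ} (hr : r ∈ box (d + 1) Lc) (cE cVH cΛ : ℝ) (k : ℕ)
    (y : Fin (d + 1) → ℤ) (ν : Fin (d + 1)) (y' : Fin (d + 1) → ℤ) (α β : Fin (d + 1)) :
    HasSum (fun xz : Site (d + 1) × Site (d + 1) =>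
        comp (comp (coDressKBmAt (toSite r) Lc (KInvStep (d := d) Lc k))
          ((1 / 2 : ℝ) • dM (conjV (coDressKBmAt (toSite r) Lc (KInvStep (d := d) Lc k))
            (diagK (((1 : ℝ) / 2) • ∑ v ∈ box (d + 1) Lc, legInd (toSite r) ((Lc : ℤ) • y + toSite v)))) Lc
            (SpureRecAt d Lc (toSite r) cE cVH cΛ k) (M1At d Lc (toSite r) cΛ k) ν y'))
          (coDressKBmAt (toSite r) Lc (KInvStep (d := d) Lc k)) ((Lc : ℤ) • xz.1) ((Lc : ℤ) • xz.2) (Sum.inr α) (Sum.inr β))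
      (-((Lc : ℝ) ^ 2 * (((((Lc ^ (k + 1) : ℕ) : ℝ)) ^ (d + 1 + 1))⁻¹) ^ 2 *
        ((1 / 2 : ℝ) *
          ((∑ κ : Fin (d + 1), ∑' u : Site (d + 1),
              colH (coDressKBmAt (toSite r) Lc (KInvStep (d := d) Lc k)) Lc ν y' κ u
                * ((if y' = y then (1 / 2 : ℝ) else 0) - (if blk Lc u = y then (1 / 2 : ℝ) else 0))
                * ∑' xz : Site (d + 1) × Site (d + 1),
                    (if xz.1 α % (Lc : ℤ) = (Lc : ℤ) - 1 ∧ xz.2 β % (Lc : ℤ) = (Lc : ℤ) - 1 then (1 : ℝ) else 0)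
                      * SpureRecAt d Lc (toSite r) cE cVH cΛ k κ u xz.1 xz.2 (Sum.inl α) (Sum.inl β))
            + ∑ ρ' : Fin (d + 1), ∑' w : Site (d + 1),
              colM (coDressKBmAt (toSite r) Lc (KInvStep (d := d) Lc k)) Lc ν y' ρ' w
                * ((if y' = y then (1 / 2 : ℝ) else 0) - (if w = y then (1 / 2 : ℝ) else 0))
                * ∑' xz : Site (d + 1) × Site (d + 1),
                    (if xz.1 α % (Lc : ℤ) = (Lc : ℤ) - 1 ∧ xz.2 β % (Lc : ℤ) = (Lc : ℤ) - 1 then (1 : ℝ) else 0)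
                      * M1At d Lc (toSite r) cΛ k ρ' w xz.1 xz.2 (Sum.inl α) (Sum.inl β))))) := by
  classical
  obtain ⟨δ, C, hδ, -, hK⟩ := decays_KInvStep (d := d) (Lc := Lc) k
  obtain ⟨CV, m, hm, hV⟩ := biLoc_rotatedVertex_comb_level hLc hr cE cVH cΛ k y ν y'
  have h := hasSum_sandwich_readout_coDressKBmAt hLc hr hK hδ hV hm α β
    (cL := fun α κ => -(if κ = α then ((((Lc ^ (k + 1) : ℕ) : ℝ)) ^ (d + 1 + 1))⁻¹ else 0))
    (cR := fun κ' μ => if κ' = μ then ((((Lc ^ (k + 1) : ℕ) : ℝ)) ^ (d + 1 + 1))⁻¹ else 0)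
    (fun t α κ => hasSum_KInvStep_inr_inl k α κ t) (fun t α m => hasSum_KInvStep_mm_left k α m t)
    (fun u κ' μ => hasSum_KInvStep_inl_inr k κ' μ u) (fun u m μ => hasSum_KInvStep_mm_right k m μ u)
  simp only [sum_sum_face_kron] at h
  rw [tsum_neg, tsum_mul_left] at h
  have hω : ∀ xz : Site (d + 1) × Site (d + 1),
      |(if xz.1 α % (Lc : ℤ) = (Lc : ℤ) - 1 ∧ xz.2 β % (Lc : ℤ) = (Lc : ℤ) - 1 then (1 : ℝ) else 0)| ≤ 1 := fun xz => by
    split_ifs <;> simp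
  have hw := hasSum_weighted_rotatedVertex_comb_level hLc hr cE cVH cΛ k y ν y' (Sum.inl α) (Sum.inl β) hω
  have e : (∑' yw : Site (d + 1) × Site (d + 1),
      (if yw.1 α % (Lc : ℤ) = (Lc : ℤ) - 1 ∧ yw.2 β % (Lc : ℤ) = (Lc : ℤ) - 1 then
        ((1 / 2 : ℝ) • dM (conjV (coDressKBmAt (toSite r) Lc (KInvStep (d := d) Lc k))
            (diagK (((1 : ℝ) / 2) • ∑ v ∈ box (d + 1) Lc, legInd (toSite r) ((Lc : ℤ) • y + toSite v)))) Lc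
            (SpureRecAt d Lc (toSite r) cE cVH cΛ k) (M1At d Lc (toSite r) cΛ k) ν y') yw.1 yw.2 (Sum.inl α) (Sum.inl β) else 0))
      = _ := (hw.congr_fun fun yw => by rw [boole_mul]).tsum_eq
  rw [e] at h
  exact h

/-! ## §2 The face weight is the product weight -/

omit [NeZero Lc] in
/-- [folklore] `𝟙[x_α % Lc = Lc−1 ∧ z_β % Lc = Lc−1] = 𝟙^{exit}_α(x)·𝟙^{exit}_β(z)`. -/
theorem faceWt_eq_exitWt (α β : Fin (d + 1)) (xz : Site (d + 1) × Site (d + 1)) :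
    (if xz.1 α % (Lc : ℤ) = (Lc : ℤ) - 1 ∧ xz.2 β % (Lc : ℤ) = (Lc : ℤ) - 1 then (1 : ℝ) else 0)
      = (if xz.1 α % (Lc : ℤ) = (Lc : ℤ) - 1 then (1 : ℝ) else 0) * (if xz.2 β % (Lc : ℤ) = (Lc : ℤ) - 1 then (1 : ℝ) else 0) := by
  by_cases h1 : xz.1 α % (Lc : ℤ) = (Lc : ℤ) - 1 <;> by_cases h2 : xz.2 β % (Lc : ℤ) = (Lc : ℤ) - 1 <;> simp [h1, h2]

/-! ## §3 The transported σ-pair per slot -/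

/-- NOT IN PRINT; OUR BOOKKEEPING.  **THE TRANSPORTED σ-PAIR PER SLOT AT LEVEL `k`** (any in-block root `ρ = toSite r`, all `cE cVH cΛ`, every `k y ν y′ α β`): the coarse
`(inr α, inr β)` entries at `(Lc•x′, Lc•z′)` of `G_k ∘ (α)_y(ν,y′) ∘ G_k` PLUS `(−½cH_k)` times those of `G_k ∘ gauge-read_k(y;ν,y′) ∘ G_k` (`cH_k = (stepScale_k·Lc^{d+1})⁻¹`; the two
sandwiches of the σ-pair's pieces, added termwise) have `HasSum` equal to `−Lc²·σ_k²·(Vα_k(y′) − ½·cH_k·Q^{comb}_k(y′))` — the PRODUCT-weight profiles of `SigmaPairSlotMomentsExit`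
(§1 + leaf-06 `hasSum_prod_comb_transported_gaugeSup` + §2). -/
theorem hasSum_transported_sigmaPair_exit_level (hLc : 1 ≤ Lc) {r : Fin (d + 1) → ℕ} (hr : r ∈ box (d + 1) Lc) (cE cVH cΛ : ℝ) (k : ℕ)
    (y : Site (d + 1)) (ν : Fin (d + 1)) (y' : Site (d + 1)) (α β : Fin (d + 1)) :
    HasSum (fun xz : Site (d + 1) × Site (d + 1) =>
        comp (comp (coDressKBmAt (toSite r) Lc (KInvStep (d := d) Lc k))
          ((1 / 2 : ℝ) • dM (conjV (coDressKBmAt (toSite r) Lc (KInvStep (d := d) Lc k))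
            (diagK (((1 : ℝ) / 2) • ∑ v ∈ box (d + 1) Lc, legInd (toSite r) ((Lc : ℤ) • y + toSite v)))) Lc
            (SpureRecAt d Lc (toSite r) cE cVH cΛ k) (M1At d Lc (toSite r) cΛ k) ν y'))
          (coDressKBmAt (toSite r) Lc (KInvStep (d := d) Lc k)) ((Lc : ℤ) • xz.1) ((Lc : ℤ) • xz.2) (Sum.inr α) (Sum.inr β)
        + (-(1 / 2 : ℝ) * (stepScale d Lc k * (Lc : ℝ) ^ (d + 1))⁻¹) *
          comp (comp (coDressKBmAt (toSite r) Lc (KInvStep (d := d) Lc k))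
            (∑ κ, wsum (fun u => ∑' x₂, ∑ κ₂,
                comp (coDressKBmAt (toSite r) Lc (KInvStep (d := d) Lc k))
                  (dM (coDressKBmAt (toSite r) Lc (KInvStep (d := d) Lc k)) Lc (SpureRecAt d Lc (toSite r) cE cVH cΛ k) (M1At d Lc (toSite r) cΛ k) ν y')
                  u x₂ (Sum.inl κ) (Sum.inl κ₂) * gaugeWt Lc y κ₂ x₂) (SpureRecAt d Lc (toSite r) cE cVH cΛ k κ)
              + ∑ ρ', cwsum Lc (fun w => ∑' x₂, ∑ κ₂,
                comp (coDressKBmAt (toSite r) Lc (KInvStep (d := d) Lc k))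
                  (dM (coDressKBmAt (toSite r) Lc (KInvStep (d := d) Lc k)) Lc (SpureRecAt d Lc (toSite r) cE cVH cΛ k) (M1At d Lc (toSite r) cΛ k) ν y')
                  ((Lc : ℤ) • w) x₂ (Sum.inr ρ') (Sum.inl κ₂) * gaugeWt Lc y κ₂ x₂) (M1At d Lc (toSite r) cΛ k ρ')))
            (coDressKBmAt (toSite r) Lc (KInvStep (d := d) Lc k)) ((Lc : ℤ) • xz.1) ((Lc : ℤ) • xz.2) (Sum.inr α) (Sum.inr β))
      (-((Lc : ℝ) ^ 2 * (((((Lc ^ (k + 1) : ℕ) : ℝ)) ^ (d + 1 + 1))⁻¹) ^ 2) *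
        ((1 / 2 : ℝ) *
          ((∑ κ : Fin (d + 1), ∑' u : Site (d + 1),
              colH (coDressKBmAt (toSite r) Lc (KInvStep (d := d) Lc k)) Lc ν y' κ u
                * ((if y' = y then (1 / 2 : ℝ) else 0) - (if blk Lc u = y then (1 / 2 : ℝ) else 0))
                * ∑' xz : Site (d + 1) × Site (d + 1),
                    ((if xz.1 α % (Lc : ℤ) = (Lc : ℤ) - 1 then (1 : ℝ) else 0) * (if xz.2 β % (Lc : ℤ) = (Lc : ℤ) - 1 then (1 : ℝ) else 0))
                      * SpureRecAt d Lc (toSite r) cE cVH cΛ k κ u xz.1 xz.2 (Sum.inl α) (Sum.inl β))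
            + ∑ ρ' : Fin (d + 1), ∑' w : Site (d + 1),
              colM (coDressKBmAt (toSite r) Lc (KInvStep (d := d) Lc k)) Lc ν y' ρ' w
                * ((if y' = y then (1 / 2 : ℝ) else 0) - (if w = y then (1 / 2 : ℝ) else 0))
                * ∑' xz : Site (d + 1) × Site (d + 1),
                    ((if xz.1 α % (Lc : ℤ) = (Lc : ℤ) - 1 then (1 : ℝ) else 0) * (if xz.2 β % (Lc : ℤ) = (Lc : ℤ) - 1 then (1 : ℝ) else 0))
                      * M1At d Lc (toSite r) cΛ k ρ' w xz.1 xz.2 (Sum.inl α) (Sum.inl β))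
          - (1 / 2 : ℝ) * (stepScale d Lc k * (Lc : ℝ) ^ (d + 1))⁻¹ *
            (∑ κ : Fin (d + 1), ∑' u : Site (d + 1),
                (∑' x₂, ∑ κ₂, comp (coDressKBmAt (toSite r) Lc (KInvStep (d := d) Lc k))
                    (dM (coDressKBmAt (toSite r) Lc (KInvStep (d := d) Lc k)) Lc (SpureRecAt d Lc (toSite r) cE cVH cΛ k) (M1At d Lc (toSite r) cΛ k) ν y')
                    u x₂ (Sum.inl κ) (Sum.inl κ₂) * gaugeWt Lc y κ₂ x₂)
                  * ∑' xz : Site (d + 1) × Site (d + 1),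
                      ((if xz.1 α % (Lc : ℤ) = (Lc : ℤ) - 1 then (1 : ℝ) else 0) * (if xz.2 β % (Lc : ℤ) = (Lc : ℤ) - 1 then (1 : ℝ) else 0))
                        * SpureRecAt d Lc (toSite r) cE cVH cΛ k κ u xz.1 xz.2 (Sum.inl α) (Sum.inl β)
              + ∑ ρ' : Fin (d + 1), ∑' w : Site (d + 1),
                (∑' x₂, ∑ κ₂, comp (coDressKBmAt (toSite r) Lc (KInvStep (d := d) Lc k))
                    (dM (coDressKBmAt (toSite r) Lc (KInvStep (d := d) Lc k)) Lc (SpureRecAt d Lc (toSite r) cE cVH cΛ k) (M1At d Lc (toSite r) cΛ k) ν y')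
                    ((Lc : ℤ) • w) x₂ (Sum.inr ρ') (Sum.inl κ₂) * gaugeWt Lc y κ₂ x₂)
                  * ∑' xz : Site (d + 1) × Site (d + 1),
                      ((if xz.1 α % (Lc : ℤ) = (Lc : ℤ) - 1 then (1 : ℝ) else 0) * (if xz.2 β % (Lc : ℤ) = (Lc : ℤ) - 1 then (1 : ℝ) else 0))
                        * M1At d Lc (toSite r) cΛ k ρ' w xz.1 xz.2 (Sum.inl α) (Sum.inl β)))) := by
  have hα := hasSum_prod_transported_rotatedVertex_comb_level hLc hr cE cVH cΛ k y ν y' α β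
  have hγ := (hasSum_prod_comb_transported_gaugeSup hLc hr cE cVH cΛ k y ν y' α β).mul_left (-(1 / 2 : ℝ) * (stepScale d Lc k * (Lc : ℝ) ^ (d + 1))⁻¹)
  have ew := faceWt_eq_exitWt (Lc := Lc) (d := d) α β
  simp only [ew] at hα hγ
  convert hα.add hγ using 1
  ring

/-! ## §4 Zero mass and zero first slot-moments of the transported σ-pair -/

omit [NeZero Lc] in
/-- [folklore] (M0) ∧ (Π) pass to a constant multiple of the profile. -/
theorem moments_smul {Z : Site (d + 1) → ℝ} {y : Site (d + 1)} (c : ℝ)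
    (h : (∑' e : Site (d + 1), Z e = 0) ∧ ∀ lam : Fin (d + 1), ∑' e : Site (d + 1), (((e - y) lam : ℤ) : ℝ) * Z e = 0) :
    (∑' e : Site (d + 1), c * Z e = 0) ∧ ∀ lam : Fin (d + 1), ∑' e : Site (d + 1), (((e - y) lam : ℤ) : ℝ) * (c * Z e) = 0 := by
  refine ⟨by rw [tsum_mul_left, h.1, mul_zero], fun lam => ?_⟩
  have e : ∀ e : Site (d + 1), (((e - y) lam : ℤ) : ℝ) * (c * Z e) = c * ((((e - y) lam : ℤ) : ℝ) * Z e) := fun e => by ring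
  rw [tsum_congr e, tsum_mul_left, h.2 lam, mul_zero]

/-- NOT IN PRINT; OUR BOOKKEEPING.  **THE TRANSPORTED σ-PAIR's PROFILE HAS (M0) ∧ (Π) AT LEVEL `k`, MODULO (W-γ)_k** (centred root, `Lc` odd, all `cE cVH cΛ`, every `k y ν α β`;
profiles bound by their defining equations as in `SigmaPairSlotMomentsExit.moments_sigmaPair_exit_of_ward_level`): with `T_k(y′) := −Lc²σ_k²·(Vα y′ − ½·cH_k·Qc y′)` (the value of §3),
`Σ' T_k = 0 ∧ ∀ λ, Σ' (y′ − y)_λ·T_k(y′) = 0`. -/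
theorem moments_transported_sigmaPair_exit_of_ward_level (hLc : Odd Lc) (cE cVH cΛ : ℝ) (k : ℕ) (y : Site (d + 1)) (ν α β : Fin (d + 1))
    {Vα Vend Qc : Site (d + 1) → ℝ}
    (hVα : ∀ y' : Site (d + 1), Vα y' =
        (1 / 2 : ℝ) *
          ((∑ κ : Fin (d + 1), ∑' u : Site (d + 1),
              colH (coDressKBmAt (toSite (ctrOff (d + 1) Lc)) Lc (KInvStep (d := d) Lc k)) Lc ν y' κ u
                * ((if y' = y then (1 / 2 : ℝ) else 0) - (if blk Lc u = y then (1 / 2 : ℝ) else 0))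
                * ∑' xz : Site (d + 1) × Site (d + 1),
                    ((if xz.1 α % (Lc : ℤ) = (Lc : ℤ) - 1 then (1 : ℝ) else 0) * (if xz.2 β % (Lc : ℤ) = (Lc : ℤ) - 1 then (1 : ℝ) else 0))
                      * SpureRecAt d Lc (toSite (ctrOff (d + 1) Lc)) cE cVH cΛ k κ u xz.1 xz.2 (Sum.inl α) (Sum.inl β))
            + ∑ ρ' : Fin (d + 1), ∑' w : Site (d + 1),
              colM (coDressKBmAt (toSite (ctrOff (d + 1) Lc)) Lc (KInvStep (d := d) Lc k)) Lc ν y' ρ' w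
                * ((if y' = y then (1 / 2 : ℝ) else 0) - (if w = y then (1 / 2 : ℝ) else 0))
                * ∑' xz : Site (d + 1) × Site (d + 1),
                    ((if xz.1 α % (Lc : ℤ) = (Lc : ℤ) - 1 then (1 : ℝ) else 0) * (if xz.2 β % (Lc : ℤ) = (Lc : ℤ) - 1 then (1 : ℝ) else 0))
                      * M1At d Lc (toSite (ctrOff (d + 1) Lc)) cΛ k ρ' w xz.1 xz.2 (Sum.inl α) (Sum.inl β)))
    (hVend : ∀ y' : Site (d + 1), Vend y' =
        (1 / 2 : ℝ) *
          ((∑ κ : Fin (d + 1), ∑' u : Site (d + 1),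
              colH (coDressKBmAt (toSite (ctrOff (d + 1) Lc)) Lc (KInvStep (d := d) Lc k)) Lc ν y' κ u
                * ((if y' + Pi.single ν 1 = y then (1 / 2 : ℝ) else 0) - (if blk Lc (u + Pi.single κ 1) = y then (1 / 2 : ℝ) else 0))
                * ∑' xz : Site (d + 1) × Site (d + 1),
                    ((if xz.1 α % (Lc : ℤ) = (Lc : ℤ) - 1 then (1 : ℝ) else 0) * (if xz.2 β % (Lc : ℤ) = (Lc : ℤ) - 1 then (1 : ℝ) else 0))
                      * SpureRecAt d Lc (toSite (ctrOff (d + 1) Lc)) cE cVH cΛ k κ u xz.1 xz.2 (Sum.inl α) (Sum.inl β))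
            + ∑ ρ' : Fin (d + 1), ∑' w : Site (d + 1),
              colM (coDressKBmAt (toSite (ctrOff (d + 1) Lc)) Lc (KInvStep (d := d) Lc k)) Lc ν y' ρ' w
                * ((if y' + Pi.single ν 1 = y then (1 / 2 : ℝ) else 0) - (if w + Pi.single ρ' 1 = y then (1 / 2 : ℝ) else 0))
                * ∑' xz : Site (d + 1) × Site (d + 1),
                    ((if xz.1 α % (Lc : ℤ) = (Lc : ℤ) - 1 then (1 : ℝ) else 0) * (if xz.2 β % (Lc : ℤ) = (Lc : ℤ) - 1 then (1 : ℝ) else 0))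
                      * M1At d Lc (toSite (ctrOff (d + 1) Lc)) cΛ k ρ' w xz.1 xz.2 (Sum.inl α) (Sum.inl β)))
    (hQc : ∀ y' : Site (d + 1), Qc y' =
        (∑ κ : Fin (d + 1), ∑' u : Site (d + 1),
            (∑' x₂, ∑ κ₂, comp (coDressKBmAt (toSite (ctrOff (d + 1) Lc)) Lc (KInvStep (d := d) Lc k))
                (dM (coDressKBmAt (toSite (ctrOff (d + 1) Lc)) Lc (KInvStep (d := d) Lc k)) Lc (SpureRecAt d Lc (toSite (ctrOff (d + 1) Lc)) cE cVH cΛ k) (M1At d Lc (toSite (ctrOff (d + 1) Lc)) cΛ k) ν y')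
                u x₂ (Sum.inl κ) (Sum.inl κ₂) * gaugeWt Lc y κ₂ x₂)
              * ∑' xz : Site (d + 1) × Site (d + 1),
                  ((if xz.1 α % (Lc : ℤ) = (Lc : ℤ) - 1 then (1 : ℝ) else 0) * (if xz.2 β % (Lc : ℤ) = (Lc : ℤ) - 1 then (1 : ℝ) else 0))
                    * SpureRecAt d Lc (toSite (ctrOff (d + 1) Lc)) cE cVH cΛ k κ u xz.1 xz.2 (Sum.inl α) (Sum.inl β)
          + ∑ ρ' : Fin (d + 1), ∑' w : Site (d + 1),
            (∑' x₂, ∑ κ₂, comp (coDressKBmAt (toSite (ctrOff (d + 1) Lc)) Lc (KInvStep (d := d) Lc k))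
                (dM (coDressKBmAt (toSite (ctrOff (d + 1) Lc)) Lc (KInvStep (d := d) Lc k)) Lc (SpureRecAt d Lc (toSite (ctrOff (d + 1) Lc)) cE cVH cΛ k) (M1At d Lc (toSite (ctrOff (d + 1) Lc)) cΛ k) ν y')
                ((Lc : ℤ) • w) x₂ (Sum.inr ρ') (Sum.inl κ₂) * gaugeWt Lc y κ₂ x₂)
              * ∑' xz : Site (d + 1) × Site (d + 1),
                  ((if xz.1 α % (Lc : ℤ) = (Lc : ℤ) - 1 then (1 : ℝ) else 0) * (if xz.2 β % (Lc : ℤ) = (Lc : ℤ) - 1 then (1 : ℝ) else 0))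
                    * M1At d Lc (toSite (ctrOff (d + 1) Lc)) cΛ k ρ' w xz.1 xz.2 (Sum.inl α) (Sum.inl β)))
    (hW : ∀ y' : Site (d + 1), Qc y' = 2 * (stepScale d Lc k * (Lc : ℝ) ^ (d + 1)) * Vend y') :
    (∑' y' : Site (d + 1), -((Lc : ℝ) ^ 2 * (((((Lc ^ (k + 1) : ℕ) : ℝ)) ^ (d + 1 + 1))⁻¹) ^ 2) * (Vα y' - (1 / 2 : ℝ) * (stepScale d Lc k * (Lc : ℝ) ^ (d + 1))⁻¹ * Qc y') = 0)
      ∧ ∀ lam : Fin (d + 1), ∑' y' : Site (d + 1), (((y' - y) lam : ℤ) : ℝ) *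
          (-((Lc : ℝ) ^ 2 * (((((Lc ^ (k + 1) : ℕ) : ℝ)) ^ (d + 1 + 1))⁻¹) ^ 2) * (Vα y' - (1 / 2 : ℝ) * (stepScale d Lc k * (Lc : ℝ) ^ (d + 1))⁻¹ * Qc y')) = 0 :=
  moments_smul _ (moments_sigmaPair_exit_of_ward_level hLc cE cVH cΛ k y ν α β hVα hVend hQc hW)

/-- NOT IN PRINT; OUR BOOKKEEPING.  **LEVEL 0, NO DISPLAYED HYPOTHESIS** (centred root, `Lc` odd, pin `cE = Lc^{d+1}`, all `cVH cΛ`, `α ≠ β`, every `y ν`): the transported σ-pair's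
profile `T₀(y′) = −Lc²σ₀²·Z₀(y′)` (`σ₀ = (Lc^{d+2})⁻¹`) has `Σ' T₀ = 0 ∧ ∀ λ, Σ' (y′ − y)_λ·T₀(y′) = 0` — the `hM0 ∕ hP1` of the (LT-3) consumer for this piece at this level. -/
theorem moments_transported_sigmaPair_exit_levelZero (hLc : Odd Lc) {cE : ℝ} (hcE : cE = (Lc : ℝ) ^ (d + 1)) (cVH cΛ : ℝ) (y : Site (d + 1)) (ν : Fin (d + 1))
    {α β : Fin (d + 1)} (hab : α ≠ β) {Vα Vend Qc : Site (d + 1) → ℝ}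
    (hVα : ∀ y' : Site (d + 1), Vα y' =
        (1 / 2 : ℝ) *
          ((∑ κ : Fin (d + 1), ∑' u : Site (d + 1),
              colH (coDressKBmAt (toSite (ctrOff (d + 1) Lc)) Lc (KInvStep (d := d) Lc 0)) Lc ν y' κ u
                * ((if y' = y then (1 / 2 : ℝ) else 0) - (if blk Lc u = y then (1 / 2 : ℝ) else 0))
                * ∑' xz : Site (d + 1) × Site (d + 1),
                    ((if xz.1 α % (Lc : ℤ) = (Lc : ℤ) - 1 then (1 : ℝ) else 0) * (if xz.2 β % (Lc : ℤ) = (Lc : ℤ) - 1 then (1 : ℝ) else 0))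
                      * SpureRecAt d Lc (toSite (ctrOff (d + 1) Lc)) cE cVH cΛ 0 κ u xz.1 xz.2 (Sum.inl α) (Sum.inl β))
            + ∑ ρ' : Fin (d + 1), ∑' w : Site (d + 1),
              colM (coDressKBmAt (toSite (ctrOff (d + 1) Lc)) Lc (KInvStep (d := d) Lc 0)) Lc ν y' ρ' w
                * ((if y' = y then (1 / 2 : ℝ) else 0) - (if w = y then (1 / 2 : ℝ) else 0))
                * ∑' xz : Site (d + 1) × Site (d + 1),
                    ((if xz.1 α % (Lc : ℤ) = (Lc : ℤ) - 1 then (1 : ℝ) else 0) * (if xz.2 β % (Lc : ℤ) = (Lc : ℤ) - 1 then (1 : ℝ) else 0))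
                      * M1At d Lc (toSite (ctrOff (d + 1) Lc)) cΛ 0 ρ' w xz.1 xz.2 (Sum.inl α) (Sum.inl β)))
    (hVend : ∀ y' : Site (d + 1), Vend y' =
        (1 / 2 : ℝ) *
          ((∑ κ : Fin (d + 1), ∑' u : Site (d + 1),
              colH (coDressKBmAt (toSite (ctrOff (d + 1) Lc)) Lc (KInvStep (d := d) Lc 0)) Lc ν y' κ u
                * ((if y' + Pi.single ν 1 = y then (1 / 2 : ℝ) else 0) - (if blk Lc (u + Pi.single κ 1) = y then (1 / 2 : ℝ) else 0))
                * ∑' xz : Site (d + 1) × Site (d + 1),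
                    ((if xz.1 α % (Lc : ℤ) = (Lc : ℤ) - 1 then (1 : ℝ) else 0) * (if xz.2 β % (Lc : ℤ) = (Lc : ℤ) - 1 then (1 : ℝ) else 0))
                      * SpureRecAt d Lc (toSite (ctrOff (d + 1) Lc)) cE cVH cΛ 0 κ u xz.1 xz.2 (Sum.inl α) (Sum.inl β))
            + ∑ ρ' : Fin (d + 1), ∑' w : Site (d + 1),
              colM (coDressKBmAt (toSite (ctrOff (d + 1) Lc)) Lc (KInvStep (d := d) Lc 0)) Lc ν y' ρ' w
                * ((if y' + Pi.single ν 1 = y then (1 / 2 : ℝ) else 0) - (if w + Pi.single ρ' 1 = y then (1 / 2 : ℝ) else 0))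
                * ∑' xz : Site (d + 1) × Site (d + 1),
                    ((if xz.1 α % (Lc : ℤ) = (Lc : ℤ) - 1 then (1 : ℝ) else 0) * (if xz.2 β % (Lc : ℤ) = (Lc : ℤ) - 1 then (1 : ℝ) else 0))
                      * M1At d Lc (toSite (ctrOff (d + 1) Lc)) cΛ 0 ρ' w xz.1 xz.2 (Sum.inl α) (Sum.inl β)))
    (hQc : ∀ y' : Site (d + 1), Qc y' =
        (∑ κ : Fin (d + 1), ∑' u : Site (d + 1),
            (∑' x₂, ∑ κ₂, comp (coDressKBmAt (toSite (ctrOff (d + 1) Lc)) Lc (KInvStep (d := d) Lc 0))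
                (dM (coDressKBmAt (toSite (ctrOff (d + 1) Lc)) Lc (KInvStep (d := d) Lc 0)) Lc (SpureRecAt d Lc (toSite (ctrOff (d + 1) Lc)) cE cVH cΛ 0) (M1At d Lc (toSite (ctrOff (d + 1) Lc)) cΛ 0) ν y')
                u x₂ (Sum.inl κ) (Sum.inl κ₂) * gaugeWt Lc y κ₂ x₂)
              * ∑' xz : Site (d + 1) × Site (d + 1),
                  ((if xz.1 α % (Lc : ℤ) = (Lc : ℤ) - 1 then (1 : ℝ) else 0) * (if xz.2 β % (Lc : ℤ) = (Lc : ℤ) - 1 then (1 : ℝ) else 0))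
                    * SpureRecAt d Lc (toSite (ctrOff (d + 1) Lc)) cE cVH cΛ 0 κ u xz.1 xz.2 (Sum.inl α) (Sum.inl β)
          + ∑ ρ' : Fin (d + 1), ∑' w : Site (d + 1),
            (∑' x₂, ∑ κ₂, comp (coDressKBmAt (toSite (ctrOff (d + 1) Lc)) Lc (KInvStep (d := d) Lc 0))
                (dM (coDressKBmAt (toSite (ctrOff (d + 1) Lc)) Lc (KInvStep (d := d) Lc 0)) Lc (SpureRecAt d Lc (toSite (ctrOff (d + 1) Lc)) cE cVH cΛ 0) (M1At d Lc (toSite (ctrOff (d + 1) Lc)) cΛ 0) ν y')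
                ((Lc : ℤ) • w) x₂ (Sum.inr ρ') (Sum.inl κ₂) * gaugeWt Lc y κ₂ x₂)
              * ∑' xz : Site (d + 1) × Site (d + 1),
                  ((if xz.1 α % (Lc : ℤ) = (Lc : ℤ) - 1 then (1 : ℝ) else 0) * (if xz.2 β % (Lc : ℤ) = (Lc : ℤ) - 1 then (1 : ℝ) else 0))
                    * M1At d Lc (toSite (ctrOff (d + 1) Lc)) cΛ 0 ρ' w xz.1 xz.2 (Sum.inl α) (Sum.inl β))) :
    (∑' y' : Site (d + 1), -((Lc : ℝ) ^ 2 * (((((Lc ^ (0 + 1) : ℕ) : ℝ)) ^ (d + 1 + 1))⁻¹) ^ 2) * (Vα y' - (1 / 2 : ℝ) * (stepScale d Lc 0 * (Lc : ℝ) ^ (d + 1))⁻¹ * Qc y') = 0)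
      ∧ ∀ lam : Fin (d + 1), ∑' y' : Site (d + 1), (((y' - y) lam : ℤ) : ℝ) *
          (-((Lc : ℝ) ^ 2 * (((((Lc ^ (0 + 1) : ℕ) : ℝ)) ^ (d + 1 + 1))⁻¹) ^ 2) * (Vα y' - (1 / 2 : ℝ) * (stepScale d Lc 0 * (Lc : ℝ) ^ (d + 1))⁻¹ * Qc y')) = 0 :=
  moments_smul _ (moments_sigmaPair_exit_levelZero hLc hcE cVH cΛ y ν hab hVα hVend hQc)

/-- NOT IN PRINT; OUR BOOKKEEPING.  **SAME DIRECTION `α = β`, EVERY LEVEL, ANY IN-BLOCK ROOT, UNCONDITIONAL**: the transported σ-pair's profile vanishes identically, so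
`Σ' T_k = 0 ∧ ∀ λ, Σ' (y′ − y)_λ·T_k(y′) = 0`. -/
theorem moments_transported_sigmaPair_exit_same_level {r : Fin (d + 1) → ℕ} (hr : r ∈ box (d + 1) Lc) (cE cVH cΛ : ℝ) (k : ℕ) (y : Site (d + 1)) (ν α : Fin (d + 1))
    {Vα Qc : Site (d + 1) → ℝ}
    (hVα : ∀ y' : Site (d + 1), Vα y' =
        (1 / 2 : ℝ) *
          ((∑ κ : Fin (d + 1), ∑' u : Site (d + 1),
              colH (coDressKBmAt (toSite r) Lc (KInvStep (d := d) Lc k)) Lc ν y' κ u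
                * ((if y' = y then (1 / 2 : ℝ) else 0) - (if blk Lc u = y then (1 / 2 : ℝ) else 0))
                * ∑' xz : Site (d + 1) × Site (d + 1),
                    ((if xz.1 α % (Lc : ℤ) = (Lc : ℤ) - 1 then (1 : ℝ) else 0) * (if xz.2 α % (Lc : ℤ) = (Lc : ℤ) - 1 then (1 : ℝ) else 0))
                      * SpureRecAt d Lc (toSite r) cE cVH cΛ k κ u xz.1 xz.2 (Sum.inl α) (Sum.inl α))
            + ∑ ρ' : Fin (d + 1), ∑' w : Site (d + 1),
              colM (coDressKBmAt (toSite r) Lc (KInvStep (d := d) Lc k)) Lc ν y' ρ' w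
                * ((if y' = y then (1 / 2 : ℝ) else 0) - (if w = y then (1 / 2 : ℝ) else 0))
                * ∑' xz : Site (d + 1) × Site (d + 1),
                    ((if xz.1 α % (Lc : ℤ) = (Lc : ℤ) - 1 then (1 : ℝ) else 0) * (if xz.2 α % (Lc : ℤ) = (Lc : ℤ) - 1 then (1 : ℝ) else 0))
                      * M1At d Lc (toSite r) cΛ k ρ' w xz.1 xz.2 (Sum.inl α) (Sum.inl α)))
    (hQc : ∀ y' : Site (d + 1), Qc y' =
        (∑ κ : Fin (d + 1), ∑' u : Site (d + 1),
            (∑' x₂, ∑ κ₂, comp (coDressKBmAt (toSite r) Lc (KInvStep (d := d) Lc k))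
                (dM (coDressKBmAt (toSite r) Lc (KInvStep (d := d) Lc k)) Lc (SpureRecAt d Lc (toSite r) cE cVH cΛ k) (M1At d Lc (toSite r) cΛ k) ν y')
                u x₂ (Sum.inl κ) (Sum.inl κ₂) * gaugeWt Lc y κ₂ x₂)
              * ∑' xz : Site (d + 1) × Site (d + 1),
                  ((if xz.1 α % (Lc : ℤ) = (Lc : ℤ) - 1 then (1 : ℝ) else 0) * (if xz.2 α % (Lc : ℤ) = (Lc : ℤ) - 1 then (1 : ℝ) else 0))
                    * SpureRecAt d Lc (toSite r) cE cVH cΛ k κ u xz.1 xz.2 (Sum.inl α) (Sum.inl α)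
          + ∑ ρ' : Fin (d + 1), ∑' w : Site (d + 1),
            (∑' x₂, ∑ κ₂, comp (coDressKBmAt (toSite r) Lc (KInvStep (d := d) Lc k))
                (dM (coDressKBmAt (toSite r) Lc (KInvStep (d := d) Lc k)) Lc (SpureRecAt d Lc (toSite r) cE cVH cΛ k) (M1At d Lc (toSite r) cΛ k) ν y')
                ((Lc : ℤ) • w) x₂ (Sum.inr ρ') (Sum.inl κ₂) * gaugeWt Lc y κ₂ x₂)
              * ∑' xz : Site (d + 1) × Site (d + 1),
                  ((if xz.1 α % (Lc : ℤ) = (Lc : ℤ) - 1 then (1 : ℝ) else 0) * (if xz.2 α % (Lc : ℤ) = (Lc : ℤ) - 1 then (1 : ℝ) else 0))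
                    * M1At d Lc (toSite r) cΛ k ρ' w xz.1 xz.2 (Sum.inl α) (Sum.inl α))) :
    (∑' y' : Site (d + 1), -((Lc : ℝ) ^ 2 * (((((Lc ^ (k + 1) : ℕ) : ℝ)) ^ (d + 1 + 1))⁻¹) ^ 2) * (Vα y' - (1 / 2 : ℝ) * (stepScale d Lc k * (Lc : ℝ) ^ (d + 1))⁻¹ * Qc y') = 0)
      ∧ ∀ lam : Fin (d + 1), ∑' y' : Site (d + 1), (((y' - y) lam : ℤ) : ℝ) *
          (-((Lc : ℝ) ^ 2 * (((((Lc ^ (k + 1) : ℕ) : ℝ)) ^ (d + 1 + 1))⁻¹) ^ 2) * (Vα y' - (1 / 2 : ℝ) * (stepScale d Lc k * (Lc : ℝ) ^ (d + 1))⁻¹ * Qc y')) = 0 :=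
  moments_smul _ (moments_sigmaPair_exit_same_level hr cE cVH cΛ k y ν α hVα hQc)

end Summit.QuantumFields.BalabanUV.Beta.GAN24.SigmaPairTransportedMomentsExit

end
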